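import Summits.ValiantsHypothesis.ValiantsHypothesis.Theorems.TwistedDetRankSliceVBPFermionicFermionants
import Summits.ValiantsHypothesis.ValiantsHypothesis.Theorems.TwistedDetRankSliceVBPFermionicTdrTransfer

/-!
# Crux `TwistedDetRank.SliceVBPFermionic` (stmt-ValiantsHypothesis-17991, X2b) — the route's other
# named candidate, the EVEN HALF of a fermionant, has positive doubling sums: `VNP ⊄ VBP`-hard

The route file names two would-be falsifiers of the fermionic normal form: "`D^even_n =
sgn·[all cycles even]` or the even half of `Ferm_2`, if either is in VP" (Theses/TwistedDetRank.lean,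
crux `FermionicNormalForm`, `why it might fail`).  `D^even` is closed by the sequel files
(…DEvenTdr, …DEvenHard).  The EVEN HALF of the pencil `Ferm^t`, i.e. the class-function GMF
`E^t_n = Σ_{σ ∈ A_n} t^{c(σ)} X^σ` (`evenHalfPencil`: the restriction of `sgn σ · t^{c(σ)}` to even
permutations), falls to the first prover's return gadget directly: its doubling sums
`c_a = Σ_{ρ : sgn σ_{1,ρ} = 1} t^{c(ρ)}` are sums of POSITIVE terms over a coset of `A_a` (non-empty
for `a ≥ 2`), hence non-zero (`doublingSum_evenHalfPencil_ne_zero`, for every natural `t ≥ 1`; for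
`t = 2`, `a ≥ 3` the value is `(a+1)!/2`).  Therefore (ReturnGadget §4, TdrTransfer §1):

* `not_dcPerSuperpolynomial_of_evenHalfPencil_hasDetRepr`: `E^t` lies in the VBP slice only if
  `VBP = VNP`;
* `evenHalfPencil_not_qpTdr`: `tdr(E^t_n)` is not quasi-polynomially bounded (`≥ (3/2)^{⌊n/6⌋}`);
* `sliceVBPFermionic_at_evenHalfPencil`: X2b AT `E^t` follows from `DcPerSuperpolynomial ℂ`.

With this row every candidate named in the route file or in Cruxes/SliceVBPFermionic/CALIBRATION.md
is `VNP ⊄ VBP`-hard in the kernel.  HONEST FRAMING: census work; X2b (≥ `VNP ⊄ VBP`) is neither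
proved nor refuted; `VP ≠ VNP` is not moved.  References: S. Mertens, C. Moore, Theory of Computing
9 (2013) 273–282; N. de Rugy-Altherre, CiE 2013, Thm. 1.  The `def` `evenHalfPencil` is a proof
gadget naming the family, not a route object.
-/

-- single-conjunct layout: Sub = Summit, duplicated namespace component intended
set_option linter.dupNamespace false

noncomputable section

namespace Summit.ValiantsHypothesis.ValiantsHypothesis.Theorems.TwistedDetRankSliceVBPFermionic

open Equiv Equiv.Perm MvPolynomial Literature.Computability.AlgebraicComplexity
open Summit.ValiantsHypothesis.ValiantsHypothesis.Theorems.TwistedDetRankFermionicNormalForm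
open scoped BigOperators

section EvenHalf

/-- THE EVEN HALF OF THE FERMIONIC PENCIL: `e^t_n(σ) = t^{c(σ)} · [σ even]` (`c` = number of cycles
counting fixed points), the coefficient function of `E^t_n = Σ_{σ ∈ A_n} t^{c(σ)} X^σ` — at `t = 2`
"the even half of `Ferm_2`" of the route file.  A proof gadget naming the family, not a route
object. [folklore] -/
def evenHalfPencil (t : ℕ) (n : ℕ) (σ : Perm (Fin n)) : ℂ :=
  if Perm.sign σ = 1 then (t : ℂ) ^ σ.numCycles else 0

/-- The even half of the pencil is a class function. [folklore] -/
theorem evenHalfPencil_conj (t n : ℕ) (σ τ : Perm (Fin n)) :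
    evenHalfPencil t n (τ * σ * τ⁻¹) = evenHalfPencil t n σ := by
  unfold evenHalfPencil
  rw [conj_eq_permCongr, Perm.sign_permCongr,
    Literature.Computability.AlgebraicComplexity.DeRugyAltherre.numCycles_permCongr]

/-- On the doubled permutation `σ_{1,ρ}` the coefficient is `t^{c(ρ)} · [ε · sgn ρ = 1]`, `ε` the
sign of the block swap. [folklore] -/
theorem evenHalfPencil_double (t : ℕ) {a : ℕ} (ρ : Perm (Fin a)) :
    evenHalfPencil t (a + a) (finSumFinEquiv.permCongr (swapPerm 1 ρ)) =
      if Perm.sign (Equiv.sumComm (Fin a) (Fin a) : Perm (Fin a ⊕ Fin a)) * Perm.sign ρ = 1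
      then (t : ℂ) ^ ρ.numCycles else 0 := by
  unfold evenHalfPencil
  rw [Perm.sign_permCongr, sign_swapPerm, Perm.sign_one, mul_one,
    Literature.Computability.AlgebraicComplexity.DeRugyAltherre.numCycles_permCongr,
    numCycles_swapPerm_one]

/-- **The doubling sums of the even half are non-zero** (`a ≥ 2`, `t ≥ 1`): a sum of positive
terms `t^{c(ρ)}` over the (non-empty) coset `{ρ : ε · sgn ρ = 1}`. [folklore] -/
theorem doublingSum_evenHalfPencil_ne_zero {t : ℕ} (ht : 1 ≤ t) {a : ℕ} (ha : 2 ≤ a) :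
    doublingSum (evenHalfPencil t (a + a)) ≠ 0 := by
  unfold doublingSum
  simp_rw [evenHalfPencil_double]
  set ε := Perm.sign (Equiv.sumComm (Fin a) (Fin a) : Perm (Fin a ⊕ Fin a)) with hε
  -- a permutation in the coset
  obtain ⟨ρ₀, hρ₀⟩ : ∃ ρ₀ : Perm (Fin a), ε * Perm.sign ρ₀ = 1 := by
    rcases Int.units_eq_one_or ε with h1 | h1
    · exact ⟨1, by rw [h1, Perm.sign_one, one_mul]⟩
    · refine ⟨swap (⟨0, by omega⟩ : Fin a) ⟨1, by omega⟩, ?_⟩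
      rw [h1, Perm.sign_swap (by simp [Fin.ext_iff])]
      decide
  -- the sum is the cast of a sum of naturals, bounded below by the `ρ₀` term
  have hcast : (∑ ρ : Perm (Fin a), (if ε * Perm.sign ρ = 1 then ((t : ℂ)) ^ ρ.numCycles else 0)) =
      ((∑ ρ : Perm (Fin a), (if ε * Perm.sign ρ = 1 then t ^ ρ.numCycles else 0) : ℕ) : ℂ) := by
    push_cast
    refine Finset.sum_congr rfl fun ρ _ => ?_
    split_ifs <;> simp
  rw [hcast, Nat.cast_ne_zero]
  have hterm : t ^ ρ₀.numCycles ≤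
      ∑ ρ : Perm (Fin a), (if ε * Perm.sign ρ = 1 then t ^ ρ.numCycles else 0) := by
    have := Finset.single_le_sum (f := fun ρ : Perm (Fin a) =>
      (if ε * Perm.sign ρ = 1 then t ^ ρ.numCycles else 0)) (fun ρ _ => Nat.zero_le _)
      (Finset.mem_univ ρ₀)
    simpa [hρ₀] using this
  have hpos : 0 < t ^ ρ₀.numCycles := Nat.pow_pos (by omega)
  omega

/-- **The even half of the pencil is `VNP ⊄ VBP`-hard** (`t ≥ 1`; `t = 2` is the route's "even
half of `Ferm_2`"): p-bounded `dc(E^t_n)` puts the permanent in VBP, by the return gadget with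
block `J` (`dc(per_a) ≤ dc(E^t_{2a}) + 1`, doubling sum `≠ 0`). [folklore] -/
theorem not_dcPerSuperpolynomial_of_evenHalfPencil_hasDetRepr {t : ℕ} (ht : 1 ≤ t)
    (hdc : ∃ c : ℕ, ∀ n : ℕ, ∃ m ≤ n ^ c + c,
      HasDetRepr (∑ σ : Perm (Fin n), C (evenHalfPencil t n σ) *
        ∏ i, (X (σ i, i) : MvPolynomial (Fin n × Fin n) ℂ)) m) :
    ¬ DcPerSuperpolynomial ℂ :=
  not_dcPerSuperpolynomial_of_hasDetRepr_of_doublingSum_ne_zero (evenHalfPencil t)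
    (evenHalfPencil_conj t) (a₀ := 2) (fun _ ha => doublingSum_evenHalfPencil_ne_zero ht ha) hdc

/-- Contrapositive: under Valiant's determinantal hypothesis the even half of the pencil is not in
the VBP slice. [folklore] -/
theorem evenHalfPencil_not_hasDetRepr_of_dcPerSuperpolynomial {t : ℕ} (ht : 1 ≤ t)
    (h : DcPerSuperpolynomial ℂ) :
    ¬ ∃ c : ℕ, ∀ n : ℕ, ∃ m ≤ n ^ c + c,
      HasDetRepr (∑ σ : Perm (Fin n), C (evenHalfPencil t n σ) *
        ∏ i, (X (σ i, i) : MvPolynomial (Fin n × Fin n) ℂ)) m :=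
  fun hdc => not_dcPerSuperpolynomial_of_evenHalfPencil_hasDetRepr ht hdc h

/-- **The even half of the pencil has super-quasi-polynomial twisted rank** (unconditionally,
`tdr ≥ (3/2)^{⌊n/6⌋}` along `n = 6m` by transfer to `per_{3m}`). [folklore] -/
theorem evenHalfPencil_not_qpTdr {t : ℕ} (ht : 1 ≤ t) :
    ¬ ∃ c : ℕ, ∀ n : ℕ, 1 ≤ n → ∃ r ≤ 2 ^ ((Nat.log 2 n + c) ^ c),
      ∃ E : Fin r → Matrix (Fin n) (Fin n) ℂ,
        (∑ σ : Perm (Fin n), C (evenHalfPencil t n σ) *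
            ∏ i, (X (σ i, i) : MvPolynomial (Fin n × Fin n) ℂ)) =
          ∑ s, (Matrix.of fun i j => C (E s i j) * MvPolynomial.X (i, j)).det :=
  not_qpTdr_of_doublingSum_ne_zero (evenHalfPencil t) (evenHalfPencil_conj t) (a₀ := 2)
    fun _ ha => doublingSum_evenHalfPencil_ne_zero ht ha

/-- **X2b AT the even half of the pencil follows from Valiant's determinantal hypothesis**
(vacuously: the family is then not in the VBP slice). [folklore] -/
theorem sliceVBPFermionic_at_evenHalfPencil {t : ℕ} (ht : 1 ≤ t) (h : DcPerSuperpolynomial ℂ) :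
    (∃ c : ℕ, ∀ n : ℕ, ∃ m ≤ n ^ c + c,
      HasDetRepr (∑ σ : Perm (Fin n), C (evenHalfPencil t n σ) *
        ∏ i, (X (σ i, i) : MvPolynomial (Fin n × Fin n) ℂ)) m) →
    ∃ c : ℕ, ∀ n : ℕ, 1 ≤ n → ∃ r ≤ 2 ^ ((Nat.log 2 n + c) ^ c),
      ∃ E : Fin r → Matrix (Fin n) (Fin n) ℂ,
        (∑ σ : Perm (Fin n), C (evenHalfPencil t n σ) *
            ∏ i, (X (σ i, i) : MvPolynomial (Fin n × Fin n) ℂ)) =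
          ∑ s, (Matrix.of fun i j => C (E s i j) * MvPolynomial.X (i, j)).det :=
  sliceVBPFermionic_restricted_of_dcPerSuperpolynomial h (evenHalfPencil t) (evenHalfPencil_conj t)
    (a₀ := 2) fun _ ha => doublingSum_evenHalfPencil_ne_zero ht ha

end EvenHalf

end Summit.ValiantsHypothesis.ValiantsHypothesis.Theorems.TwistedDetRankSliceVBPFermionic

end
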